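import Mathlib
import Summits.KontsevichZagierPeriods.Zeta5Search.BrickTopCoefficient

/-!
# BrickTopFrobenius — the digit-pole law for leading coefficients:
`c_{jp,A}(np) = p^ε · Φ_{n,p}(−j) · c_{j,A}(n)` for the brick kernel (cell zeta5-irr)

HONEST FRAMING: systematic search; no irrationality claim unless certified. INSTRUMENT lemma of the ζ(5)
census cell zeta5-irr (HOME `run/shared/lean/pub/zeta5-irr/`; memo `zi-p2/LEMMAS.md` §B8-a′ THEOREM3.md Step 3
«DIGIT POLES: comparing principal parts at t = −j, c_{jp,2}(np) = Φ(−j)·c_{j,2}(n)» and §B8-a″ THEOREM 5 Step B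
«ONE-STEP FROBENIUS COMPARISON p^{τ_s}c_{jp,s}(np) = Σ_m φ_m(j)c_{j,s+m}(n)» at `s = A`, `m = 0`). Nothing here is
about ζ(5); no irrationality content; filing moves no rung. Filed by the engine seat zi-eng (g7); sequel of
`BrickKernelFrobenius` (zi-eng g6: `p^A·R_{np}(pt) = p^ε·Φ_{n,p}(t)·R_n(t)`) and `BrickTopCoefficient`.

## The statement

With `g^{(n)}_j(t) = R_n(t)·(t+j)^A` the regular part of the brick kernel at the digit pole `−j`
(`BrickTopCoefficient.topFun`; value `c_{j,A}(n) = cTop A B ε n j` at `t = −j`), the Frobenius factorisation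
multiplied by `(pt + jp)^A = p^A(t+j)^A` reads, AS AN IDENTITY OF THE DEFINING PRODUCTS (so also AT the pole):

**`g^{(np)}_{jp}(pt) = p^ε · Φ_{n,p}(t) · g^{(n)}_j(t)`** for every `t` (`topFun_frobenius`; the denominator splits as
`∏_{m≤np, m≠jp}(pt+m) = pⁿ·∏_{m≤n, m≠j}(t+m)·∏_{p∤ℓ≤np}(pt+ℓ)`, `prod_range_erase_mul_add`), and at `t = −j`:

**`c_{jp,A}(np) = p^ε · Φ_{n,p}(−j) · c_{j,A}(n)`** (`cTop_mul_prime`) — the leading coefficient at a DIGIT pole of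
`R_{np}` is the leading coefficient of `R_n` at the corresponding pole times `p^ε·Φ_{n,p}(−j)`, where
`Φ_{n,p}(−j) ≡ 1 + λ_p q_n(j) (mod p⁴)` (`BrickPhiFour`). For `ε = 1` this is zi-p2's `p^{τ_A}c_{jp,A}(np) =
φ_0·c_{j,A}(n)`, `τ_A = −1`.
-/

namespace Summit.KontsevichZagierPeriods.Zeta5Search.BrickTopFrobenius

open Finset Nat
open Summit.KontsevichZagierPeriods.Zeta5Search.FrobeniusFactorisation (prod_range_mul_succ_eq_mul_prod_filter
  prod_Icc_mul_sub factorial_mul_eq)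
open Summit.KontsevichZagierPeriods.Zeta5Search.BrickKernelFrobenius (brickPhi prod_Icc_mul_add_mul)
open Summit.KontsevichZagierPeriods.Zeta5Search.BrickTopCoefficient (topFun cTop topFun_neg_natCast)

section splitting

variable {R : Type*} [CommRing R] {p : ℕ}

/-- **Denominator with the digit pole removed**: for `j ≤ n`,
`∏_{0≤m≤np, m≠jp}(pt + m) = pⁿ · ∏_{0≤m≤n, m≠j}(t + m) · ∏_{1≤ℓ≤np, p∤ℓ}(pt + ℓ)`. [folklore] -/
theorem prod_range_erase_mul_add (hp : 0 < p) {n j : ℕ} (hj : j ≤ n) (t : R) :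
    ∏ m ∈ (range (n * p + 1)).erase (j * p), ((p : R) * t + m) =
      (p : R) ^ n * (∏ m ∈ (range (n + 1)).erase j, (t + m)) *
        ∏ m ∈ (Icc 1 (n * p)).filter (fun m => ¬ p ∣ m), ((p : R) * t + m) := by
  classical
  -- replace the factor at `jp` by `1` and split the full product into multiples / non-multiples of `p`
  set f : ℕ → R := fun m => if m = j * p then 1 else (p : R) * t + m with hf
  have hjp : j * p ∈ range (n * p + 1) := mem_range.2 (by nlinarith)
  have hj' : j ∈ range (n + 1) := mem_range.2 (by omega)
  have hf1 : f (j * p) = 1 := by simp [hf]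
  have hf2 : f (p * j) = 1 := by simp [hf, mul_comm]
  have hL : ∏ m ∈ (range (n * p + 1)).erase (j * p), ((p : R) * t + m) = ∏ m ∈ range (n * p + 1), f m := by
    calc ∏ m ∈ (range (n * p + 1)).erase (j * p), ((p : R) * t + m)
        = ∏ m ∈ (range (n * p + 1)).erase (j * p), f m :=
          Finset.prod_congr rfl fun m hm => by simp [hf, Finset.ne_of_mem_erase hm]
      _ = f (j * p) * ∏ m ∈ (range (n * p + 1)).erase (j * p), f m := by rw [hf1, one_mul]
      _ = ∏ m ∈ range (n * p + 1), f m := Finset.mul_prod_erase _ f hjp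
  have h1 : ∏ m ∈ range (n + 1), f (p * m) = (p : R) ^ n * ∏ m ∈ (range (n + 1)).erase j, (t + m) := by
    have h : ∀ m ∈ (range (n + 1)).erase j, f (p * m) = (p : R) * (t + m) := by
      intro m hm
      have hne : p * m ≠ j * p := fun h =>
        Finset.ne_of_mem_erase hm (Nat.eq_of_mul_eq_mul_left hp (by rw [h, mul_comm]))
      simp only [hf, if_neg hne]
      push_cast
      ring
    calc ∏ m ∈ range (n + 1), f (p * m)
        = f (p * j) * ∏ m ∈ (range (n + 1)).erase j, f (p * m) :=
          (Finset.mul_prod_erase _ (fun m => f (p * m)) hj').symm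
      _ = ∏ m ∈ (range (n + 1)).erase j, ((p : R) * (t + m)) := by
          rw [hf2, one_mul]; exact Finset.prod_congr rfl h
      _ = (p : R) ^ n * ∏ m ∈ (range (n + 1)).erase j, (t + m) := by
          rw [Finset.prod_mul_distrib, Finset.prod_const, Finset.card_erase_of_mem hj', Finset.card_range,
            Nat.add_sub_cancel]
  have h2 : ∏ m ∈ (Icc 1 (n * p)).filter (fun m => ¬ p ∣ m), f m =
      ∏ m ∈ (Icc 1 (n * p)).filter (fun m => ¬ p ∣ m), ((p : R) * t + m) := by
    refine Finset.prod_congr rfl fun m hm => ?_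
    have hne : m ≠ j * p := fun h => (mem_filter.1 hm).2 ⟨j, by rw [h, mul_comm]⟩
    simp only [hf, if_neg hne]
  rw [hL, prod_range_mul_succ_eq_mul_prod_filter hp n f, h1, h2]

end splitting

section kernel

variable {K : Type*} [Field K]

/-- The algebra: for `x ≠ 0`,
`(xⁿ e w)^C (s h) (xⁿ a c)^B (xⁿ a' c')^B / (xⁿ b d)^{C+2B} = s · (w^C c^B c'^B / d^{C+2B}) · (e^C h a^B a'^B / b^{C+2B})`
(both sides vanish when `b = 0` or `d = 0` and `C + 2B ≥ 1`). [folklore] -/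
private theorem algebra {x : K} (hx : x ≠ 0) (n B C : ℕ) (a a' b c c' d e w h s : K) :
    (x ^ n * e * w) ^ C * (s * h) * (x ^ n * a * c) ^ B * (x ^ n * a' * c') ^ B / (x ^ n * b * d) ^ (C + 2 * B) =
      s * (w ^ C * c ^ B * c' ^ B / d ^ (C + 2 * B)) * (e ^ C * h * a ^ B * a' ^ B / b ^ (C + 2 * B)) := by
  rcases Nat.eq_zero_or_pos (C + 2 * B) with h0 | h0
  · have hC : C = 0 := by omega
    have hB : B = 0 := by omega
    subst hC; subst hB
    simp only [mul_zero, add_zero, pow_zero, one_mul, mul_one, div_one]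
  by_cases hb : b = 0
  · subst hb; simp [zero_pow h0.ne']
  by_cases hd : d = 0
  · subst hd; simp [zero_pow h0.ne']
  field_simp
  ring

/-- **The Frobenius factorisation at the level of regular parts** (identity of the defining products, valid at the
pole as well): for `2B ≤ A`, `p ≥ 1` invertible in `K`, `j ≤ n` and every `t`:
`g^{(np)}_{jp}(pt) = p^ε · Φ_{n,p}(t) · g^{(n)}_j(t)`. -/
theorem topFun_frobenius {A B : ℕ} (hAB : 2 * B ≤ A) (ε : ℕ) {p : ℕ} (hp : 0 < p) (hpK : (p : K) ≠ 0)
    {n j : ℕ} (hj : j ≤ n) (t : K) :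
    topFun A B ε (n * p) (j * p) ((p : K) * t) = (p : K) ^ ε * brickPhi A B p n t * topFun A B ε n j t := by
  obtain ⟨C, rfl⟩ : ∃ C, A = C + 2 * B := ⟨A - 2 * B, by omega⟩
  unfold topFun brickPhi
  rw [Nat.add_sub_cancel, prod_Icc_mul_sub hp n t, prod_Icc_mul_add_mul hp n t, prod_range_erase_mul_add hp hj t,
    factorial_mul_eq hp n]
  have hvwp : ((p : K) * t + ((n * p : ℕ) : K) / 2) ^ ε = (p : K) ^ ε * (t + (n : K) / 2) ^ ε := by
    rw [← mul_pow]; congr 1; push_cast; ring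
  rw [hvwp]
  push_cast
  have key := algebra hpK n B C (∏ m ∈ Icc 1 n, (t - (m : K))) (∏ m ∈ Icc 1 n, (t + n + (m : K)))
    (∏ m ∈ (range (n + 1)).erase j, (t + (m : K)))
    (∏ m ∈ (Icc 1 (n * p)).filter (fun m => ¬ p ∣ m), ((p : K) * t - (m : K)))
    (∏ m ∈ (Icc 1 (n * p)).filter (fun m => ¬ p ∣ m), ((p : K) * t + (n : K) * (p : K) + (m : K)))
    (∏ m ∈ (Icc 1 (n * p)).filter (fun m => ¬ p ∣ m), ((p : K) * t + (m : K)))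
    (n ! : K) (∏ m ∈ (Icc 1 (n * p)).filter (fun m => ¬ p ∣ m), (m : K)) ((t + (n : K) / 2) ^ ε) ((p : K) ^ ε)
  linear_combination key

end kernel

/-- **The digit-pole law for the leading coefficients**: for `2B ≤ A`, a prime (indeed any) `p ≥ 1`, and
`j ≤ n`: `c_{jp,A}(np) = p^ε · Φ_{n,p}(−j) · c_{j,A}(n)`, i.e.
`cTop A B ε (np) (jp) = p^ε · brickPhi A B p n (−j) · cTop A B ε n j`. -/
theorem cTop_mul_prime {A B : ℕ} (hAB : 2 * B ≤ A) (ε : ℕ) {p : ℕ} (hp : 0 < p) {n j : ℕ} (hj : j ≤ n) :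
    cTop A B ε (n * p) (j * p) = (p : ℚ) ^ ε * brickPhi A B p n (-(j : ℚ)) * cTop A B ε n j := by
  have hpQ : (p : ℚ) ≠ 0 := by exact_mod_cast hp.ne'
  have h := topFun_frobenius hAB ε hp hpQ hj (-(j : ℚ))
  rw [show (p : ℚ) * -(j : ℚ) = -((j * p : ℕ) : ℚ) by push_cast; ring,
    topFun_neg_natCast hAB ε (Nat.mul_le_mul_right p hj), topFun_neg_natCast hAB ε hj] at h
  exact h

/-- Sanity instance (`(A,B,ε) = (4,1,1)`, `p = 5`, `n = 1`, `j = 0`): `c_{0,4}(5) = 5·Φ_{1,5}(0)·c_{0,4}(1)`, i.e.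
`−(5/2)·C(5,0)⁴·C(10,5) = −630 = 5·126·(−1)` (`Φ_{1,5}(0) = 126`, `c_{0,4}(1) = −(1/2)·1·(1·2) = −1`). -/
example : cTop 4 1 1 (1 * 5) (0 * 5) = (5 : ℚ) ^ 1 * brickPhi 4 1 5 1 (-((0 : ℕ) : ℚ)) * cTop 4 1 1 1 0 :=
  cTop_mul_prime (by norm_num) 1 (by norm_num) (Nat.zero_le 1)

end Summit.KontsevichZagierPeriods.Zeta5Search.BrickTopFrobenius
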